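import Summits.AtomisticToContinuum.Crystallization.Theorems.RepetitiveNetworkReductionRecurrentMember
import Summits.AtomisticToContinuum.Crystallization.Theorems.FrustratedLawDichotomyLocalLimitEngine
import Summits.AtomisticToContinuum.Crystallization.Theorems.FrustratedLawDichotomyFolnerRadius

/-!
# `NetworkRecurrenceTransfer.stub_evaporationLaw` — part 2/3: Følner windows of a μ-ground state and their energy

Registered stub `stub_evaporationLaw` of `NetworkRecurrenceTransfer` (RED, `stmt-AtomisticToContinuum-27236`, route
`RepetitiveNetworkReduction`, sub-problem `Crystallization` of `AtomisticToContinuum`), written by the decomp-a2c cell's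
lens-2 g18 seat. This part produces, from ONE rooted `δ`-separated `e⋆`-μ-ground-state configuration `S ⊆ ℝ³`
(`IsMuGSC lennardJones eStar S`), the window data fed to the Benjamini–Schramm engine
`FrustratedLawDichotomyLocalLimitEngine.exists_windowLimit`:

* `sum_abs_lennardJones_le_sep` — crude absolute bound `Σ_{z ∈ t} |V_LJ(|p − z|)| ≤ B(δ)` over a `δ`-separated finite
  set at distance `≥ δ` from `p` (pointwise bound `BenjaminiSchrammLimit.abs_lennardJones_le` + packing sum
  `BenjaminiSchrammLimit.Finset.sum_norm_inv_pow_five_le`);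
* `neg_le_tsum_of_sum_abs_le` — a `tsum` is `≥ −c` once all finite absolute partial sums are `≤ c`;
* `window_energy_le` — EMPTYING A WINDOW (`k = 0` in the μGSC inequality): the interaction energy of the window
  `x = S ∩ B̄(0,r)` is `≤ e⋆ · #x + #(shell) · B(δ) + #x · (1/4)·250 δ⁻⁵ T⁻¹`, the shell being the non-`T`-deep
  window points (their outside field is bounded crudely, the deep points' outside field by the uniform far tail
  `LocalLimitStable.sum_abs_lennardJones_le_of_far`);
* `exists_windows` — windows `w m = S ∩ B̄(0, r m)` at Følner radii `r m ∈ [m/4, m/2]` with thin shells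
  (`FrustratedLawDichotomyFolnerRadius.stub_folnerRadius`): separated, exhausting, with vanishing non-deep fractions and,
  for every `c > e⋆`, eventually `𝓔(w m) ≤ c · #(w m)`.

All `[folklore]`. No new definitions.
-/

open scoped BigOperators Topology
open Filter Set Metric MeasureTheory

namespace Summit.AtomisticToContinuum.Crystallization.Theorems.RepetitiveNetworkReductionEvaporationLaw

open Literature.MathematicalPhysics.StatisticalMechanics
open Summit.AtomisticToContinuum.Crystallization.Theorems.RepetitiveNetworkReductionRecurrentMember
open Summit.AtomisticToContinuum.Crystallization.Theorems.BenjaminiSchrammLimit (abs_lennardJones_le)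

/-! ## Absolute field bounds -/

/-- **Crude absolute field bound.** If the points of the finite set `t ⊆ ℝ³` are pairwise `≥ δ` apart and at distance
`≥ δ` from `p` unless equal to `p`, then `Σ_{z ∈ t} |V_LJ(|p − z|)| ≤ 250 ((1/12) δ⁻⁷ + (1/6) δ⁻¹) δ⁻⁵` (the term `z = p`
vanishes, `V_LJ(0) = 0`). [folklore] -/
theorem sum_abs_lennardJones_le_sep (t : Finset (EuclideanSpace ℝ (Fin 3))) (p : EuclideanSpace ℝ (Fin 3)) {δ : ℝ}
    (hδ : 0 < δ) (hp : ∀ z ∈ t, z ≠ p → δ ≤ dist p z) (ht : ∀ z ∈ t, ∀ w ∈ t, z ≠ w → δ ≤ dist z w) :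
    ∑ z ∈ t, |lennardJones (dist p z)| ≤ 250 * (((1 / 12) * δ⁻¹ ^ 7 + (1 / 6) * δ⁻¹) * δ⁻¹ ^ 5) := by
  classical
  have h0 : ∑ z ∈ t, |lennardJones (dist p z)| = ∑ z ∈ t.erase p, |lennardJones (dist p z)| := by
    by_cases h : p ∈ t
    · rw [← Finset.add_sum_erase t _ h, dist_self, lennardJones_zero, abs_zero, zero_add]
    · rw [Finset.erase_eq_of_notMem h]
  rw [h0]
  have ht1 : ∀ z ∈ t.erase p, δ ≤ dist p z := fun z hz =>
    hp z (Finset.mem_of_mem_erase hz) (Finset.ne_of_mem_erase hz)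
  have hinj : ∀ z ∈ t.erase p, ∀ w ∈ t.erase p, (fun q : EuclideanSpace ℝ (Fin 3) => q - p) z =
      (fun q : EuclideanSpace ℝ (Fin 3) => q - p) w → z = w := fun z _ w _ h => sub_left_injective h
  have hsumT : ∑ z ∈ t.erase p, (dist p z)⁻¹ ^ 5 =
      ∑ y ∈ (t.erase p).image (fun q => q - p), ‖y‖⁻¹ ^ 5 := by
    rw [Finset.sum_image hinj]
    refine Finset.sum_congr rfl fun z _ => ?_
    rw [dist_comm, dist_eq_norm]
  have hsepT : ∀ y ∈ (t.erase p).image (fun q => q - p), ∀ y' ∈ (t.erase p).image (fun q => q - p),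
      y ≠ y' → δ ≤ dist y y' := by
    intro y hy y' hy' hne
    obtain ⟨z, hz, rfl⟩ := Finset.mem_image.1 hy
    obtain ⟨z', hz', rfl⟩ := Finset.mem_image.1 hy'
    rw [dist_sub_right]
    exact ht z (Finset.mem_of_mem_erase hz) z' (Finset.mem_of_mem_erase hz') fun h => hne (by rw [h])
  have h0T : ∀ y ∈ (t.erase p).image (fun q => q - p), δ ≤ ‖y‖ := by
    intro y hy
    obtain ⟨z, hz, rfl⟩ := Finset.mem_image.1 hy
    rw [← dist_eq_norm, dist_comm]
    exact ht1 z hz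
  calc ∑ z ∈ t.erase p, |lennardJones (dist p z)|
      ≤ ∑ z ∈ t.erase p, ((1 / 12) * δ⁻¹ ^ 7 + (1 / 6) * δ⁻¹) * (dist p z)⁻¹ ^ 5 :=
        Finset.sum_le_sum fun z hz => abs_lennardJones_le hδ (ht1 z hz)
    _ = ((1 / 12) * δ⁻¹ ^ 7 + (1 / 6) * δ⁻¹) * ∑ z ∈ t.erase p, (dist p z)⁻¹ ^ 5 := by rw [Finset.mul_sum]
    _ ≤ ((1 / 12) * δ⁻¹ ^ 7 + (1 / 6) * δ⁻¹) * (250 * δ⁻¹ ^ 5) := by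
        refine mul_le_mul_of_nonneg_left ?_ (by positivity)
        rw [hsumT]
        exact BenjaminiSchrammLimit.Finset.sum_norm_inv_pow_five_le _ hδ hsepT h0T
    _ = 250 * (((1 / 12) * δ⁻¹ ^ 7 + (1 / 6) * δ⁻¹) * δ⁻¹ ^ 5) := by ring

/-- A real family all of whose finite absolute partial sums are `≤ c` has `tsum ≥ −c`. [folklore] -/
theorem neg_le_tsum_of_sum_abs_le {ι : Type*} {f : ι → ℝ} {c : ℝ} (h : ∀ u : Finset ι, ∑ i ∈ u, |f i| ≤ c) :
    -c ≤ ∑' i, f i := by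
  have habs : Summable fun i => |f i| := summable_of_sum_le (fun i => abs_nonneg (f i)) h
  have hnorm : Summable fun i => ‖f i‖ := by simpa only [Real.norm_eq_abs] using habs
  have h1 : |∑' i, f i| ≤ c :=
    calc |∑' i, f i| ≤ ∑' i, |f i| := by
          simpa only [Real.norm_eq_abs] using norm_tsum_le_tsum_norm hnorm
      _ ≤ c := habs.tsum_le_of_sum_le h
  exact neg_le_of_abs_le h1

/-! ## Emptying a window -/

/-- **Energy of a window of a μ-ground state.** Let `S` be `δ`-separated and an `e⋆`-μGSC of `V_LJ`, and let the
injective `x : Fin n → S` contain every point of `S` in `B̄(0, r)`. If every index outside `D` is `T`-deep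
(`dist (x i) 0 ≤ r − T`, `T ≥ max 1 δ`), then `𝓔(x) ≤ e⋆ n + #D · B(δ) + n · (1/4)·250 δ⁻⁵ T⁻¹`: empty the window
(`k = 0` in the μGSC inequality) and bound the window–outside interaction below. [folklore] -/
theorem window_energy_le {δ : ℝ} (hδ : 0 < δ) {S : Set (EuclideanSpace ℝ (Fin 3))}
    (hsep : ∀ p ∈ S, ∀ q ∈ S, p ≠ q → δ ≤ dist p q) (hM : IsMuGSC lennardJones eStar S) {n : ℕ}
    (x : Fin n → EuclideanSpace ℝ (Fin 3)) (hx : Function.Injective x) (hxS : Set.range x ⊆ S) {r T : ℝ}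
    (hδT : δ ≤ T) (h1T : 1 ≤ T) (hwin : ∀ q ∈ S, dist q 0 ≤ r → q ∈ Set.range x) (D : Finset (Fin n))
    (hD : ∀ i, i ∉ D → dist (x i) 0 ≤ r - T) :
    interactionEnergy lennardJones x ≤ eStar * n +
      D.card * (250 * (((1 / 12) * δ⁻¹ ^ 7 + (1 / 6) * δ⁻¹) * δ⁻¹ ^ 5)) + n * (1 / 4 * (250 * δ⁻¹ ^ 5 * T⁻¹)) := by
  -- emptying the window: `k = 0`
  have key := hM.2 n x hx hxS 0 (fun _ : Fin 0 => (0 : EuclideanSpace ℝ (Fin 3))) (fun a => a.elim0)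
    (by simp [Set.range_eq_empty])
  have hR0 : interactionEnergy lennardJones (fun _ : Fin 0 => (0 : EuclideanSpace ℝ (Fin 3))) = 0 := by
    simp [interactionEnergy]
  have key' : interactionEnergy lennardJones x +
      (∑ i, ∑' y : ↥(S \ Set.range x), lennardJones (dist (x i) y)) - eStar * n ≤ 0 := by
    have h2 := key
    simp only [hR0, Finset.univ_eq_empty, Finset.sum_empty, Nat.cast_zero, mul_zero, sub_zero, add_zero] at h2
    exact h2
  -- per-point lower bounds of the outside field
  have hY : ∀ p ∈ S \ Set.range x, ∀ q ∈ S \ Set.range x, p ≠ q → δ ≤ dist p q :=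
    fun p hp q hq hne => hsep p hp.1 q hq.1 hne
  have hin : ∀ i : Fin n, -((if i ∈ D then (250 * (((1 / 12) * δ⁻¹ ^ 7 + (1 / 6) * δ⁻¹) * δ⁻¹ ^ 5)) else 0) +
      1 / 4 * (250 * δ⁻¹ ^ 5 * T⁻¹)) ≤ ∑' y : ↥(S \ Set.range x), lennardJones (dist (x i) y) := by
    intro i
    refine neg_le_tsum_of_sum_abs_le fun u => ?_
    have hmem : ∀ z ∈ u.map (Function.Embedding.subtype (· ∈ S \ Set.range x)), z ∈ S \ Set.range x := by
      intro z hz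
      obtain ⟨q, -, rfl⟩ := Finset.mem_map.1 hz
      exact q.2
    have hsepu : ∀ z ∈ u.map (Function.Embedding.subtype (· ∈ S \ Set.range x)),
        ∀ w ∈ u.map (Function.Embedding.subtype (· ∈ S \ Set.range x)), z ≠ w → δ ≤ dist z w :=
      fun z hz w hw hne => hY z (hmem z hz) w (hmem w hw) hne
    have hBc0 : (0 : ℝ) ≤ 250 * (((1 / 12) * δ⁻¹ ^ 7 + (1 / 6) * δ⁻¹) * δ⁻¹ ^ 5) := by positivity
    have hFa0 : (0 : ℝ) ≤ 1 / 4 * (250 * δ⁻¹ ^ 5 * T⁻¹) := by positivity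
    by_cases hi : i ∈ D
    · have h := sum_abs_lennardJones_le_sep (u.map (Function.Embedding.subtype (· ∈ S \ Set.range x))) (x i) hδ
        (fun z hz hne => hsep _ (hxS ⟨i, rfl⟩) _ (hmem z hz).1 hne.symm) hsepu
      rw [Finset.sum_map] at h
      have h' : ∑ q ∈ u, |lennardJones (dist (x i) (q : EuclideanSpace ℝ (Fin 3)))| ≤
          250 * (((1 / 12) * δ⁻¹ ^ 7 + (1 / 6) * δ⁻¹) * δ⁻¹ ^ 5) := h
      rw [if_pos hi]
      linarith
    · have hfar : ∀ z ∈ u.map (Function.Embedding.subtype (· ∈ S \ Set.range x)), T ≤ dist (x i) z := by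
        intro z hz
        have hz' := hmem z hz
        have hzr : r < dist z 0 := by
          by_contra hle
          exact hz'.2 (hwin z hz'.1 (not_lt.1 hle))
        have := hD i hi
        linarith [dist_triangle z (x i) 0, dist_comm z (x i)]
      have h := LocalLimitStable.sum_abs_lennardJones_le_of_far
        (u.map (Function.Embedding.subtype (· ∈ S \ Set.range x))) (x i) hδ hδT h1T hsepu hfar
      rw [Finset.sum_map] at h
      have h' : ∑ q ∈ u, |lennardJones (dist (x i) (q : EuclideanSpace ℝ (Fin 3)))| ≤
          1 / 4 * (250 * δ⁻¹ ^ 5 * T⁻¹) := h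
      rw [if_neg hi]
      linarith
  -- add up
  have e1 : ∑ i : Fin n, (if i ∈ D then (250 * (((1 / 12) * δ⁻¹ ^ 7 + (1 / 6) * δ⁻¹) * δ⁻¹ ^ 5)) else (0 : ℝ)) =
      D.card * (250 * (((1 / 12) * δ⁻¹ ^ 7 + (1 / 6) * δ⁻¹) * δ⁻¹ ^ 5)) := by
    rw [Finset.sum_ite_mem, Finset.univ_inter, Finset.sum_const, nsmul_eq_mul]
  have e2 : ∑ _i : Fin n, (1 / 4 * (250 * δ⁻¹ ^ 5 * T⁻¹) : ℝ) = n * (1 / 4 * (250 * δ⁻¹ ^ 5 * T⁻¹)) := by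
    rw [Finset.sum_const, Finset.card_univ, Fintype.card_fin, nsmul_eq_mul]
  have hsum : -(∑ i, ∑' y : ↥(S \ Set.range x), lennardJones (dist (x i) y)) ≤
      D.card * (250 * (((1 / 12) * δ⁻¹ ^ 7 + (1 / 6) * δ⁻¹) * δ⁻¹ ^ 5)) + n * (1 / 4 * (250 * δ⁻¹ ^ 5 * T⁻¹)) := by
    rw [← Finset.sum_neg_distrib, ← e1, ← e2, ← Finset.sum_add_distrib]
    exact Finset.sum_le_sum fun i _ => by linarith [hin i]
  linarith

/-! ## Følner windows -/

/-- Enumeration of a finite set of points by `Fin N`. [folklore] -/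
theorem exists_enum (F : Finset (EuclideanSpace ℝ (Fin 3))) :
    ∃ (N : ℕ) (y : Fin N → EuclideanSpace ℝ (Fin 3)), Function.Injective y ∧ Set.range y = ↑F := by
  refine ⟨F.card, fun j => ((F.equivFin.symm j : {q // q ∈ F}) : EuclideanSpace ℝ (Fin 3)),
    Subtype.val_injective.comp F.equivFin.symm.injective, ?_⟩
  ext q
  constructor
  · rintro ⟨j, rfl⟩
    exact (F.equivFin.symm j).2
  · intro hq
    exact ⟨F.equivFin ⟨q, hq⟩, by simp⟩

/-- **Følner windows of a rooted separated μ-ground state.** For `S ∋ 0` `δ`-separated with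
`IsMuGSC lennardJones eStar S` there are windows `w m : Fin (n m) → S` (`n m ≠ 0`) enumerating `S ∩ B̄(0, r m)`,
`δ`-separated, and thresholds `t m → 0`, `t m ≥ 0`, such that for every depth `M` eventually the non-`M`-deep points of
`w m` number `≤ t m · n m`, and for every `c > e⋆` eventually `𝓔(w m) ≤ c · n m`. [folklore] -/
theorem exists_windows {δ : ℝ} (hδ : 0 < δ) {S : Set (EuclideanSpace ℝ (Fin 3))} (h0 : (0 : EuclideanSpace ℝ (Fin 3)) ∈ S)
    (hsep : ∀ p ∈ S, ∀ q ∈ S, p ≠ q → δ ≤ dist p q) (hM : IsMuGSC lennardJones eStar S) :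
    ∃ (n : ℕ → ℕ) (w : (m : ℕ) → Fin (n m) → EuclideanSpace ℝ (Fin 3)) (r t : ℕ → ℝ), (∀ m, n m ≠ 0) ∧
      (∀ (m : ℕ) (a b : Fin (n m)), a ≠ b → δ ≤ dist (w m a) (w m b)) ∧ (∀ m a, w m a ∈ S) ∧
      (∀ m, ∀ q ∈ S, dist q 0 ≤ r m → q ∈ Set.range (w m)) ∧ (∀ m a, dist (w m a) 0 ≤ r m) ∧
      (∀ m, 0 ≤ t m) ∧ Tendsto t atTop (𝓝 0) ∧
      (∀ M : ℕ, ∀ᶠ m in atTop,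
        ((Finset.univ.filter fun a : Fin (n m) => r m < dist (w m a) 0 + M).card : ℝ) ≤ t m * n m) ∧
      (∀ c : ℝ, eStar < c → ∀ᶠ m in atTop, interactionEnergy lennardJones (w m) ≤ c * n m) := by
  obtain ⟨Ls, εs, hLs, hεs, hF⟩ := FrustratedLawDichotomyFolnerRadius.stub_folnerRadius δ hδ
  have hLs' : Tendsto (fun m : ℕ => Ls m) atTop atTop := hLs.comp tendsto_natCast_atTop_atTop
  have hεs' : Tendsto (fun m : ℕ => εs m) atTop (𝓝 0) := hεs.comp tendsto_natCast_atTop_atTop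
  -- enumerate `S ∩ B̄(0, m)` with the root indexed
  have hfin : ∀ m : ℕ, (S ∩ closedBall (0 : EuclideanSpace ℝ (Fin 3)) m).Finite := fun m =>
    finite_of_forall_le_dist_of_subset_closedBall hδ (fun p hp q hq => hsep p hp.1 q hq.1) Set.inter_subset_right
  have henum : ∀ m : ℕ, ∃ (N : ℕ) (y : Fin N → EuclideanSpace ℝ (Fin 3)) (i : Fin N), Function.Injective y ∧
      Set.range y = S ∩ closedBall (0 : EuclideanSpace ℝ (Fin 3)) m ∧ y i = 0 := by
    intro m
    obtain ⟨N, y, hy, hr⟩ := exists_enum (hfin m).toFinset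
    rw [Set.Finite.coe_toFinset] at hr
    have h0m : (0 : EuclideanSpace ℝ (Fin 3)) ∈ Set.range y := by
      rw [hr]; exact ⟨h0, mem_closedBall_self (Nat.cast_nonneg m)⟩
    obtain ⟨i, hi⟩ := h0m
    exact ⟨N, y, i, hy, hr, hi⟩
  choose N y i hy hyr hyi using henum
  have hyS : ∀ m j, y m j ∈ S := fun m j => by
    have h : y m j ∈ S ∩ closedBall (0 : EuclideanSpace ℝ (Fin 3)) m := hyr m ▸ Set.mem_range_self j
    exact h.1
  have hysep : ∀ (m : ℕ) (a b : Fin (N m)), a ≠ b → δ ≤ dist (y m a) (y m b) := fun m a b hab =>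
    hsep _ (hyS m a) _ (hyS m b) fun h => hab (hy m h)
  -- Følner radii
  have hrad : ∀ m : ℕ, ∃ r : ℝ, (m : ℝ) / 4 ≤ r ∧ r ≤ (m : ℝ) / 2 ∧
      ((Finset.univ.filter fun j : Fin (N m) => r - Ls m < dist (y m j) 0 ∧ dist (y m j) 0 ≤ r).card : ℝ) ≤
        εs m * ((Finset.univ.filter fun j : Fin (N m) => dist (y m j) 0 ≤ r).card : ℝ) := by
    intro m
    have h := hF (m : ℝ) (N m) (y m) (i m) (Nat.cast_nonneg m) (hysep m)
    simpa only [hyi] using h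
  choose r hr1 hr2 hshell using hrad
  -- the windows `J m = {j | |y m j| ≤ r m}`, enumerated increasingly by `f m`
  obtain ⟨J, hJ⟩ : ∃ J : (m : ℕ) → Finset (Fin (N m)), ∀ m : ℕ,
      (Finset.univ.filter fun j : Fin (N m) => dist (y m j) 0 ≤ r m) = J m := ⟨_, fun _ => rfl⟩
  simp only [hJ] at hshell
  have hJmem : ∀ (m : ℕ) (j : Fin (N m)), j ∈ J m ↔ dist (y m j) 0 ≤ r m := fun m j => by
    rw [← hJ]; simp
  have hr0 : ∀ m, 0 ≤ r m := fun m => le_trans (by positivity) (hr1 m)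
  have hiJ : ∀ m, i m ∈ J m := fun m => (hJmem m _).2 (by rw [hyi, dist_self]; exact hr0 m)
  have hn : ∀ m : ℕ, (J m).card ≠ 0 := fun m => Finset.card_ne_zero_of_mem (hiJ m)
  obtain ⟨f, hf⟩ : ∃ f : (m : ℕ) → (Fin (J m).card ↪o Fin (N m)),
      ∀ m : ℕ, f m = (J m).orderEmbOfFin rfl := ⟨_, fun _ => rfl⟩
  have hfmem : ∀ (m : ℕ) (a : Fin (J m).card), f m a ∈ J m := fun m a => by
    rw [hf]; exact Finset.orderEmbOfFin_mem _ _ _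
  have hfsurj : ∀ (m : ℕ) (j : Fin (N m)), j ∈ J m → ∃ a : Fin (J m).card, f m a = j := by
    intro m j hj
    have h := Finset.range_orderEmbOfFin (J m) rfl
    rw [← hf m] at h
    have hj' : j ∈ Set.range (f m) := by rw [h]; exact Finset.mem_coe.2 hj
    exact hj'
  have hball : ∀ (m : ℕ) (a : Fin (J m).card), dist (y m (f m a)) 0 ≤ r m := fun m a => (hJmem m _).1 (hfmem m a)
  have hwin : ∀ m : ℕ, ∀ q ∈ S, dist q 0 ≤ r m → q ∈ Set.range fun a : Fin (J m).card => y m (f m a) := by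
    intro m q hq hqr
    have hqm : q ∈ S ∩ closedBall (0 : EuclideanSpace ℝ (Fin 3)) m :=
      ⟨hq, mem_closedBall.2 (hqr.trans (by linarith [hr2 m, hr0 m]))⟩
    rw [← hyr m] at hqm
    obtain ⟨j, rfl⟩ := hqm
    obtain ⟨a, ha⟩ := hfsurj m j ((hJmem m j).2 hqr)
    exact ⟨a, by simp only [ha]⟩
  have htlim : Tendsto (fun m : ℕ => max (εs m) 0) atTop (𝓝 0) := by
    simpa using hεs'.max (tendsto_const_nhds : Tendsto (fun _ : ℕ => (0 : ℝ)) atTop (𝓝 0))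
  -- shells are thin
  have hshell' : ∀ (m : ℕ) (L : ℝ), L ≤ Ls m →
      ((Finset.univ.filter fun a : Fin (J m).card => r m - L < dist (y m (f m a)) 0).card : ℝ) ≤
        max (εs m) 0 * (J m).card := by
    intro m L hL
    refine le_trans (Nat.cast_le.2 (Finset.card_le_card_of_injOn (fun a => f m a) (fun a ha => ?_)
      fun a _ b _ h => (f m).injective h)) ((hshell m).trans
        (mul_le_mul_of_nonneg_right (le_max_left _ _) (Nat.cast_nonneg _)))
    rw [Finset.mem_coe, Finset.mem_filter] at ha ⊢
    exact ⟨Finset.mem_univ _, by linarith [ha.2], hball m a⟩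
  refine ⟨fun m => (J m).card, fun m a => y m (f m a), r, fun m => max (εs m) 0, hn,
    fun m a b hab => hysep m _ _ fun h => hab ((f m).injective h), fun m a => hyS m _, hwin, hball,
    fun m => le_max_right _ _, htlim, fun M => ?_, fun c hc => ?_⟩
  · filter_upwards [hLs'.eventually_ge_atTop (M : ℝ)] with m hM
    refine le_trans (le_of_eq ?_) (hshell' m M hM)
    congr 2
    ext a
    simp only [Finset.mem_filter, Finset.mem_univ, true_and]
    constructor <;> intro h <;> linarith
  · have hsmall : ∀ᶠ m : ℕ in atTop, max (εs m) 0 * (250 * (((1 / 12) * δ⁻¹ ^ 7 + (1 / 6) * δ⁻¹) * δ⁻¹ ^ 5)) +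
        1 / 4 * (250 * δ⁻¹ ^ 5 * (Ls m)⁻¹) < c - eStar := by
      have h1 : Tendsto (fun m : ℕ => max (εs m) 0 * (250 * (((1 / 12) * δ⁻¹ ^ 7 + (1 / 6) * δ⁻¹) * δ⁻¹ ^ 5)) +
          1 / 4 * (250 * δ⁻¹ ^ 5 * (Ls m)⁻¹)) atTop
          (𝓝 (0 * (250 * (((1 / 12) * δ⁻¹ ^ 7 + (1 / 6) * δ⁻¹) * δ⁻¹ ^ 5)) + 1 / 4 * (250 * δ⁻¹ ^ 5 * 0))) :=
        (htlim.mul_const _).add ((hLs'.inv_tendsto_atTop.const_mul _).const_mul _)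
      rw [zero_mul, mul_zero, mul_zero, zero_add] at h1
      exact (tendsto_order.1 h1).2 _ (by linarith)
    filter_upwards [hsmall, hLs'.eventually_ge_atTop (max 1 δ)] with m hm hLm
    have h1T : 1 ≤ Ls m := (le_max_left _ _).trans hLm
    have hδT : δ ≤ Ls m := (le_max_right _ _).trans hLm
    have hD : ∀ a : Fin (J m).card, a ∉ (Finset.univ.filter fun a : Fin (J m).card =>
        r m - Ls m < dist (y m (f m a)) 0) → dist (y m (f m a)) 0 ≤ r m - Ls m := fun a ha =>
      not_lt.1 fun h => ha (Finset.mem_filter.2 ⟨Finset.mem_univ _, h⟩)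
    have hE := window_energy_le hδ hsep hM (fun a : Fin (J m).card => y m (f m a))
      (fun a b h => (f m).injective (hy m h)) (by rintro _ ⟨a, rfl⟩; exact hyS m _) hδT h1T (hwin m) _ hD
    have hDc := hshell' m (Ls m) le_rfl
    have hcard0 : (0 : ℝ) ≤ (J m).card := Nat.cast_nonneg _
    have hBc0 : (0 : ℝ) ≤ 250 * (((1 / 12) * δ⁻¹ ^ 7 + (1 / 6) * δ⁻¹) * δ⁻¹ ^ 5) := by positivity
    have h2 := mul_le_mul_of_nonneg_right hDc hBc0
    have h3 := mul_le_mul_of_nonneg_left hm.le hcard0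
    show interactionEnergy lennardJones (fun a : Fin (J m).card => y m (f m a)) ≤ c * ((J m).card : ℝ)
    nlinarith [hE, h2, h3]

end Summit.AtomisticToContinuum.Crystallization.Theorems.RepetitiveNetworkReductionEvaporationLaw
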